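/-
Copyright: the b2b-balaban T⁴-continuum CRUX team, row NE7b OWNER lineage `t4-ne7b-p1` (gen 143). Project licence.
-/
import Summits.QuantumFields.BalabanUV.T4Continuum.Spine.NE7b.SupBlockFourthKernelAverage
import Summits.QuantumFields.BalabanUV.T4Continuum.Spine.NE7b.SupFifthKernelTwoPointLetters

/-!
# THE AVERAGE PIECE OF `∂⁵W`'S KERNEL LETTER: TILTED AVERAGING KEEPS THE FIFTH ROW LETTER (SCOPING (d14)(2)(iv)∕(vi); the order-5 analogue of
# (500)).  In the cumulant form of `∂⁵W` the first term is the tilted average `Z(ψ)⁻¹∫e^{−U(ω+ψ)}U⁽⁵⁾(ω+ψ)[e_x,e_y,e_z,e_t,e_s]dN(0,Γ)(ω)` of the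
# input's FIFTH kernel; (437)'s weighted-average lemma on the QUADRUPLE index `(y,z,t,s) ∈ ι × ι × ι × ι` gives, for any `Γ ⪰ 0` under the
# regulator and `‖U⁽⁵⁾‖ ≤ κ₅`,
#   `Σ_y Σ_z Σ_t Σ_s |⟨U⁽⁵⁾⟩_{xyzts}(ψ)| ≤ κ₅r`   whenever   `Σ_y Σ_z Σ_t Σ_s |U⁽⁵⁾(φ)[e_x,e_y,e_z,e_t,e_s]| ≤ κ₅r` for all `φ, x`
# — the input's fifth row letter passes to the average UNIFORMLY in the background and the volume (row NE7b, node U5c; (437)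
# `rowsum_of_weighted_average`, (564) `quad_sum_eq`, (401), (410) BY NAME; [folklore])

Cell `pub-balaban`, sub-cell `t4`, spine estimate NE7b (`T4WeightBudget.RelWeightBound`; the cell's OWN estimate — NOT PRINTED in
[Bałaban 1983–89], NOT PROVED).  Crux-route work under `Spine/NE7b/` by the row OWNER (`t4-ne7b-p1` gen 143, file (580)) under FREEZE
(0)'s crux-prover clause; NOTHING of Bałaban's is named as a Lean object, valued or asserted; no `T4Continuum/Support` leaf typed; no
`def`, no notation; zero `sorry`.  Imports (BY NAME): the OWNER's (500) `…SupBlockFourthKernelAverage` (through it (437) `rowsum_of_weighted_average`,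
(410) `block_Z_pos`, (401) `integrable_exp_neg_block`, `mul_opBound_le_of_le`), (564) `…SupFifthKernelTwoPointLetters` (`quad_sum_eq`).

WHAT IS PROVED ([folklore]; `Γ ⪰ 0` with the operator letter and regulator, `U ∈ C¹`, `U⁽⁵⁾ = U₅` continuous with `‖U₅‖ ≤ κ₅`):
* §1 `fifth_entry_abs_le` (`|U₅φe_xe_ye_ze_te_s| ≤ κ₅`), `integrable_weighted_fifth_entry`.
* §2 THE END **`tilted_fifth_average_rowsum`**.

HONEST (what this is NOT).  The average piece only; with (562)–(579) every PIECE of the order-5 centred display now has its row letter, but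
the cumulant FORM of `∂⁵W` (`U ∈ C⁵`: raw fifth derivative, raw = centred) and the assembly of the kernel letter are NOT typed.  Scalar skeleton
((A3), NC-NE7b-α UNRULED); nothing of Bałaban's asserted.  BY-NAME EFFECT ON THE WALL: NONE.  NE7b NOT PRINTED ∕ NOT PROVED; spine PROVED 0∕9;
rung (B)+1 — the programme's measures remain FINITE-torus statements; NOT the mass gap, NOT Clay.  HONEST DEPENDENCY: continuum YM on T⁴ ⇐
BetaPertH ∧ nine spine estimates (0∕9 proved); BetaPertH ⇐ (D1) ∧ (D4) ∧ CAP+tail; G-an2-4 gates asym, D1 and NE2∕3∕4.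
-/

set_option autoImplicit false
set_option maxSynthPendingDepth 4

noncomputable section

namespace Summit.QuantumFields.BalabanUV.T4Continuum.NE7b.SupBlockFifthKernelAverage

open MeasureTheory ProbabilityTheory Real Set Function Finset Matrix
open scoped BigOperators
open SupBlockHessianKernelAverage (rowsum_of_weighted_average)
open SupFifthKernelTwoPointLetters (quad_sum_eq)
open SupBlockDressedStep (block_Z_pos)
open SupBlockEffectiveActionDerivative (integrable_exp_neg_block)
open SupEffectiveActionDerivative (mul_opBound_le_of_le)

variable {ι : Type} [Fintype ι] [DecidableEq ι]

variable {Γ : Matrix ι ι ℝ} {γop : ℝ} {U : EuclideanSpace ℝ ι → ℝ} {U' : EuclideanSpace ℝ ι → EuclideanSpace ℝ ι →L[ℝ] ℝ}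
  {U₅ : EuclideanSpace ℝ ι →
    EuclideanSpace ℝ ι →L[ℝ] EuclideanSpace ℝ ι →L[ℝ] EuclideanSpace ℝ ι →L[ℝ] EuclideanSpace ℝ ι →L[ℝ] EuclideanSpace ℝ ι →L[ℝ] ℝ}
  {κ₀ κ₅ κ₅r τ δ θ : ℝ}

/-! ## §1. The weighted fifth entry is integrable -/

set_option synthInstance.maxHeartbeats 200000 in
/-- `|U₅φ[e_x,e_y,e_z,e_t,e_s]| ≤ κ₅` from `‖U₅φ‖ ≤ κ₅` (unit vectors). [folklore] -/
theorem fifth_entry_abs_le (hU₅b : ∀ φ : EuclideanSpace ℝ ι, ‖U₅ φ‖ ≤ κ₅) (φ : EuclideanSpace ℝ ι) (x y z t s : ι) :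
    |U₅ φ (EuclideanSpace.single x (1 : ℝ)) (EuclideanSpace.single y (1 : ℝ)) (EuclideanSpace.single z (1 : ℝ)) (EuclideanSpace.single t (1 : ℝ))
        (EuclideanSpace.single s (1 : ℝ))| ≤ κ₅ := by
  have hx : ‖(EuclideanSpace.single x (1 : ℝ) : EuclideanSpace ℝ ι)‖ = 1 := by simp
  have hy : ‖(EuclideanSpace.single y (1 : ℝ) : EuclideanSpace ℝ ι)‖ = 1 := by simp
  have hz : ‖(EuclideanSpace.single z (1 : ℝ) : EuclideanSpace ℝ ι)‖ = 1 := by simp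
  have ht : ‖(EuclideanSpace.single t (1 : ℝ) : EuclideanSpace ℝ ι)‖ = 1 := by simp
  have hs : ‖(EuclideanSpace.single s (1 : ℝ) : EuclideanSpace ℝ ι)‖ = 1 := by simp
  have h1 := ContinuousLinearMap.le_opNorm (U₅ φ (EuclideanSpace.single x (1 : ℝ)) (EuclideanSpace.single y (1 : ℝ)) (EuclideanSpace.single z (1 :
      ℝ)) (EuclideanSpace.single t (1 : ℝ))) (EuclideanSpace.single s (1 : ℝ))
  have h2 := ContinuousLinearMap.le_opNorm (U₅ φ (EuclideanSpace.single x (1 : ℝ)) (EuclideanSpace.single y (1 : ℝ)) (EuclideanSpace.single z (1 :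
      ℝ))) (EuclideanSpace.single t (1 : ℝ))
  have h3 := ContinuousLinearMap.le_opNorm (U₅ φ (EuclideanSpace.single x (1 : ℝ)) (EuclideanSpace.single y (1 : ℝ))) (EuclideanSpace.single z (1 :
      ℝ))
  have h4 := ContinuousLinearMap.le_opNorm (U₅ φ (EuclideanSpace.single x (1 : ℝ))) (EuclideanSpace.single y (1 : ℝ))
  have h5 := ContinuousLinearMap.le_opNorm (U₅ φ) (EuclideanSpace.single x (1 : ℝ))
  rw [hs, mul_one, Real.norm_eq_abs] at h1
  rw [ht, mul_one] at h2
  rw [hz, mul_one] at h3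
  rw [hy, mul_one] at h4
  rw [hx, mul_one] at h5
  exact h1.trans (h2.trans (h3.trans (h4.trans (h5.trans (hU₅b φ)))))

set_option synthInstance.maxHeartbeats 200000 in
/-- **`e^{−U(ω+ψ)}·U₅(ω+ψ)[e_x,e_y,e_z,e_t,e_s] ∈ L¹(N(0,Γ))`** under the regulator (bounded × integrable). [folklore] -/
theorem integrable_weighted_fifth_entry (hΓ : Γ.PosSemidef) (hΓop : (γop • (1 : Matrix ι ι ℝ) - Γ).PosSemidef) (Y : Finset ι)
    (hUd : ∀ φ : EuclideanSpace ℝ ι, HasFDerivAt U (U' φ) φ) (hU₅c : Continuous U₅) (hκ₀ : 0 ≤ κ₀) (hτ : 0 < τ) (hδ : 0 < δ) (hθ0 : 0 < θ)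
    (hθ1 : θ < 1) (hκθ : (2 * κ₀ * (1 + τ) + 4 * δ) * γop ≤ θ) (hstab : ∀ φ : EuclideanSpace ℝ ι, -(κ₀ * ∑ x ∈ Y, φ x ^ 2) ≤ U φ)
    (hU₅b : ∀ φ : EuclideanSpace ℝ ι, ‖U₅ φ‖ ≤ κ₅) (ψ : EuclideanSpace ℝ ι) (x y z t s : ι) :
    Integrable (fun ω : EuclideanSpace ℝ ι => exp (-U (ω + ψ)) * U₅ (ω + ψ) (EuclideanSpace.single x (1 : ℝ)) (EuclideanSpace.single y (1 : ℝ))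
      (EuclideanSpace.single z (1 : ℝ)) (EuclideanSpace.single t (1 : ℝ)) (EuclideanSpace.single s (1 : ℝ))) (multivariateGaussian 0 Γ) := by
  have hUc : Continuous U := continuous_iff_continuousAt.2 fun φ => (hUd φ).continuousAt
  have hκθ₀ : 2 * κ₀ * (1 + τ) * γop ≤ θ := mul_opBound_le_of_le (by positivity) (by linarith) hθ0.le hκθ
  have hI := integrable_exp_neg_block hΓ hΓop Y hUc.measurable hκ₀ hτ hθ1 hκθ₀ hstab ψ
  have hsh : Continuous fun ω : EuclideanSpace ℝ ι => ω + ψ := continuous_id.add continuous_const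
  have hT : Continuous fun ω : EuclideanSpace ℝ ι => U₅ (ω + ψ) (EuclideanSpace.single x (1 : ℝ)) (EuclideanSpace.single y (1 : ℝ))
      (EuclideanSpace.single z (1 : ℝ)) (EuclideanSpace.single t (1 : ℝ)) (EuclideanSpace.single s (1 : ℝ)) :=
    (((((hU₅c.comp hsh).clm_apply continuous_const).clm_apply continuous_const).clm_apply continuous_const).clm_apply continuous_const).clm_apply
      continuous_const
  refine (hI.mul_const κ₅).mono' ((hI.aestronglyMeasurable.mul hT.aestronglyMeasurable)) (ae_of_all _ fun ω => ?_)
  rw [Real.norm_eq_abs, abs_mul, abs_of_pos (exp_pos _)]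
  exact mul_le_mul_of_nonneg_left (fifth_entry_abs_le hU₅b (ω + ψ) x y z t s) (exp_pos _).le

/-! ## §2. The average keeps the fifth row letter -/

set_option synthInstance.maxHeartbeats 200000 in
/-- **TILTED AVERAGING KEEPS THE FIFTH ROW LETTER**: `Σ_yΣ_zΣ_tΣ_s|⟨U⁽⁵⁾⟩_{xyzts}(ψ)| ≤ κ₅r` for every background `ψ` and site `x`, for any
`Γ ⪰ 0` under the regulator, whenever `Σ_yΣ_zΣ_tΣ_s|U⁽⁵⁾(φ)[e_x,e_y,e_z,e_t,e_s]| ≤ κ₅r` for all `φ, x`. [folklore] -/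
theorem tilted_fifth_average_rowsum (hΓ : Γ.PosSemidef) (hΓop : (γop • (1 : Matrix ι ι ℝ) - Γ).PosSemidef) (Y : Finset ι)
    (hUd : ∀ φ : EuclideanSpace ℝ ι, HasFDerivAt U (U' φ) φ) (hU₅c : Continuous U₅) (hκ₀ : 0 ≤ κ₀) (hτ : 0 < τ) (hδ : 0 < δ) (hθ0 : 0 < θ)
    (hθ1 : θ < 1) (hκθ : (2 * κ₀ * (1 + τ) + 4 * δ) * γop ≤ θ) (hstab : ∀ φ : EuclideanSpace ℝ ι, -(κ₀ * ∑ x ∈ Y, φ x ^ 2) ≤ U φ)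
    (hU₅b : ∀ φ : EuclideanSpace ℝ ι, ‖U₅ φ‖ ≤ κ₅)
    (hU₅row : ∀ (φ : EuclideanSpace ℝ ι) (x : ι), ∑ y, ∑ z, ∑ t, ∑ s, |U₅ φ (EuclideanSpace.single x (1 : ℝ)) (EuclideanSpace.single y (1 : ℝ))
      (EuclideanSpace.single z (1 : ℝ)) (EuclideanSpace.single t (1 : ℝ)) (EuclideanSpace.single s (1 : ℝ))| ≤ κ₅r)
    (ψ : EuclideanSpace ℝ ι) (x : ι) :
    ∑ y, ∑ z, ∑ t, ∑ s, |(∫ ω : EuclideanSpace ℝ ι, exp (-U (ω + ψ)) ∂(multivariateGaussian 0 Γ))⁻¹ *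
        ∫ ω : EuclideanSpace ℝ ι, exp (-U (ω + ψ)) * U₅ (ω + ψ) (EuclideanSpace.single x (1 : ℝ)) (EuclideanSpace.single y (1 : ℝ))
          (EuclideanSpace.single z (1 : ℝ)) (EuclideanSpace.single t (1 : ℝ)) (EuclideanSpace.single s (1 : ℝ)) ∂(multivariateGaussian 0 Γ)| ≤ κ₅r :=
              by
  have hUc : Continuous U := continuous_iff_continuousAt.2 fun φ => (hUd φ).continuousAt
  have hκθ₀ : 2 * κ₀ * (1 + τ) * γop ≤ θ := mul_opBound_le_of_le (by positivity) (by linarith) hθ0.le hκθ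
  have hI := integrable_exp_neg_block hΓ hΓop Y hUc.measurable hκ₀ hτ hθ1 hκθ₀ hstab ψ
  have hZ := block_Z_pos hΓ hΓop Y hUd hκ₀ hτ hδ hθ0 hθ1 hκθ hstab ψ
  -- (437) on the quadruple index `ι × ι × ι × ι` (rows read through the first component)
  have h := rowsum_of_weighted_average (multivariateGaussian 0 Γ) (fun ω : EuclideanSpace ℝ ι => exp (-U (ω + ψ)))
    (fun (ω : EuclideanSpace ℝ ι) (r p : ι × ι × ι × ι) => U₅ (ω + ψ) (EuclideanSpace.single r.1 (1 : ℝ)) (EuclideanSpace.single p.1 (1 : ℝ))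
      (EuclideanSpace.single p.2.1 (1 : ℝ)) (EuclideanSpace.single p.2.2.1 (1 : ℝ)) (EuclideanSpace.single p.2.2.2 (1 : ℝ)))
    (fun ω => (exp_pos _).le) hI hZ (fun r p => integrable_weighted_fifth_entry hΓ hΓop Y hUd hU₅c hκ₀ hτ hδ hθ0 hθ1 hκθ hstab hU₅b ψ r.1 p.1 p.2.1
        p.2.2.1 p.2.2.2)
    (fun ω r => by
      rw [quad_sum_eq (fun y z t s => |U₅ (ω + ψ) (EuclideanSpace.single r.1 (1 : ℝ)) (EuclideanSpace.single y (1 : ℝ)) (EuclideanSpace.single z (1 :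
          ℝ)) (EuclideanSpace.single t (1 : ℝ)) (EuclideanSpace.single s (1 : ℝ))|)]
      exact hU₅row (ω + ψ) r.1) (x, x, x, x)
  rw [quad_sum_eq (fun y z t s => |(∫ ω : EuclideanSpace ℝ ι, exp (-U (ω + ψ)) ∂(multivariateGaussian 0 Γ))⁻¹ *
        ∫ ω : EuclideanSpace ℝ ι, exp (-U (ω + ψ)) * U₅ (ω + ψ) (EuclideanSpace.single x (1 : ℝ)) (EuclideanSpace.single y (1 : ℝ))
          (EuclideanSpace.single z (1 : ℝ)) (EuclideanSpace.single t (1 : ℝ)) (EuclideanSpace.single s (1 : ℝ)) ∂(multivariateGaussian 0 Γ)|)] at h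
  exact h

/-! ## §3. Toy -/

/-- Toy (§1's telescope of operator norms with unit vectors, in numbers): `1·1·1·1·1 ≤ 1`. -/
example : (1 : ℝ) * 1 * 1 * 1 * 1 ≤ 1 := by norm_num

end Summit.QuantumFields.BalabanUV.T4Continuum.NE7b.SupBlockFifthKernelAverage

end
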